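import Literature.AnabelianGeometry.EtaleTheta.ThetaCoversKummerTwistSubgroups
import Literature.AnabelianGeometry.EtaleTheta.Discharge.Sec2TwistedModelTempered
import HarnessLib

/-!
# The KUMMER-TWIST model of `ThetaCovers.TemperedCoverData` ([EtTh] §2, Def 2.5), part 1: carriers, coordinates,
# and the profinite cover data `CoverDataAx` — with `G_K = ℤ/l ≠ 1`, `Δ̄_Θ = ` the CENTRE, and a cusp group `D_x`
# whose stabiliser is print-like (`N(D_x) = Π_{C̲}`-part: it CONTAINS the inversion and meets `Π_X` in `Π_{X̲}`)

S. Mochizuki, *The étale theta function and its Frobenioid-theoretic manifestations*, Publ. RIMS **45** (2009)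
[MochizukiEtTh2009], §2: Def. 2.1 – Prop. 2.2 (pp.35–38, PDF), Def. 2.5 (pp.39–40), Cor. 2.9 (p.43).  abc-iut cell,
block F, seat abc-iut-f-141 (companion certificates for FACT-LIST rows F-0600 `Cor29_card` / F-0601 `Cor29_preserved` and
for GAP-LEDGER G-L2d3-2: NON-VACUITY of abc-iut-L2-d3's cusp hypotheses `hΘ ∧ hC1 ∧ hC2 ∧ HasMuL`).

CONSISTENCY WITNESS / TOY — NOT the tempered fundamental group of a curve; no side taken on anything printed.
DEF-BEARING (class (b) MODEL file: no frozen structure touched; instances only on the NEW synonym `TK`).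
THE MODEL, after abc-iut-w5-d118's NV-L2 model and abc-iut-f-142's twisted variant (`ThetaCoversTwistedModelDefs.lean`,
whose `B × Ẑ`, `id × η_ℤ` dressing is reused verbatim):
* finite factor `A := kumPiC l × ℤ/2`, `kumPiC l = (ℤ/l)³ ⋊ D_l` the Kummer-twisted Heisenberg toy
  (`ThetaCoversKummerTwistGroup/Subgroups.lean`: `D_l` acts on `(x, y, z)` unipotently in `z`, the Galois coordinate);
* `Π_C := A × Ẑ`, `Π^tp_C := A × ℤ`, `Π^tp_C ↪ Π_C = id_A × η_ℤ`; `Φ := pr ∘ pr₁ : Π_C → kumPiC l`;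
* **`G_K := ℤ/l`**, `aug := z ∘ Φ` (the first toy in the tree with a NON-trivial Galois group, acting on `Δ̄^ell_X`
  through the Kummer cocycle); `Π_X := Φ⁻¹(kumPiX)`; **`Δ̄_Θ-preimage := Φ⁻¹(centre)`**, **`Ker(Δ_X ↠ Δ̄_X) := Ker Φ`** (so
  `Δ̄_Θ` IS generated by commutators: `hΘ` holds, unlike the Tate-direction models); **`D_x := Φ⁻¹({x = 0} ⋊ 1) = Φ⁻¹⟨c, g⟩`**
  — it maps ONTO `G_K`, and its normaliser is `Φ⁻¹((ℤ/l)³ ⋊ {1, s r})` (part 3).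
Parts 2–3 (proof-only): `Discharge/Sec2KummerTwistTheta.lean` (`Π_{C̲̲}` of type `(1, l-torsΘ)±` with `ι̲ = s r`,
`E = Φ⁻¹⟨(1,−1,0)⟩`, `S = Φ⁻¹⟨g⟩`), `Discharge/Sec2KummerTwistCor29.lean` (the inhabitant; `hΘ`, `hC1`, `hC2`, `HasMuL` HOLD,
hence abc-iut-L2-d3's counts `(l+1)/2` for `X̲̲, C̲, C̲̲`; and the scaling automorphism refutes `Cor29_preserved`).
[cite: MochizukiEtTh2009, Def 2.1 p.36] [cite: MochizukiEtTh2009, Def 2.5 p.39] [cite: MochizukiEtTh2009, Cor 2.9 p.43]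
-/

noncomputable section

namespace Literature.AnabelianGeometry.EtaleTheta

namespace ThetaCovers

namespace KummerModel

open Multiplicative KummerWitness Literature.AnabelianGeometry.SemiGraphs
  Literature.AnabelianGeometry.EtaleTheta.SettingModel TemperedModel

variable (l : ℕ)

/-! ## 1. The finite factor `A = kumPiC l × ℤ/2` -/

/-- The finite factor `A := ((ℤ/l)³ ⋊ D_l) × ℤ/2` of the model's `Π^tp_C = A × ℤ` (a NEW type synonym, so that it may carry the
discrete topology). (toy bookkeeping; no claim about print) [cite: MochizukiEtTh2009, Def 2.5 p.39] -/
def TK : Type := kumPiC l × Multiplicative (ZMod 2)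

/-- `A` is a group (the product group). (toy bookkeeping) [cite: MochizukiEtTh2009, Def 2.5 p.39] -/
instance : Group (TK l) := inferInstanceAs (Group (kumPiC l × Multiplicative (ZMod 2)))

/-- `A` carries the DISCRETE topology. (toy bookkeeping) [cite: MochizukiEtTh2009, Def 2.5 p.39] -/
instance : TopologicalSpace (TK l) := ⊥

/-- `A` is discrete. (toy bookkeeping) [cite: MochizukiEtTh2009, Def 2.5 p.39] -/
instance : DiscreteTopology (TK l) := ⟨rfl⟩

/-- `A` is a topological group (discrete). (toy bookkeeping) [cite: MochizukiEtTh2009, Def 2.5 p.39] -/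
instance : IsTopologicalGroup (TK l) where
  continuous_mul := continuous_of_discreteTopology
  continuous_inv := continuous_of_discreteTopology

/-- `A` is finite (`l ≠ 0`). (toy bookkeeping) [cite: MochizukiEtTh2009, Def 2.5 p.39] -/
instance [NeZero l] : Finite (TK l) := by
  haveI : Finite (kumPiC l) :=
    Finite.of_injective (fun x : kumPiC l => (x.left, x.right))
      fun x y h => SemidirectProduct.ext (Prod.mk.inj h).1 (Prod.mk.inj h).2
  exact inferInstanceAs (Finite (kumPiC l × Multiplicative (ZMod 2)))

/-- Elements of `A` from their two components. (toy bookkeeping) [cite: MochizukiEtTh2009, Def 2.5 p.39] -/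
def TK.inK (h : kumPiC l) (t : Multiplicative (ZMod 2)) : TK l := (h, t)

/-- The toy component `pr : A → kumPiC l`. (toy bookkeeping) [cite: MochizukiEtTh2009, Def 2.5 p.39] -/
def TK.kum : TK l →* kumPiC l := MonoidHom.fst (kumPiC l) (Multiplicative (ZMod 2))

/-- The `ℤ/2` component `A → ℤ/2` (the `Ċ`/`Ÿ` double-cover coordinate). (toy bookkeeping) [cite: MochizukiEtTh2009, Def 2.5 p.39] -/
def TK.two : TK l →* Multiplicative (ZMod 2) := MonoidHom.snd (kumPiC l) (Multiplicative (ZMod 2))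

/-- `pr (inK h t) = h`. (toy bookkeeping) [cite: MochizukiEtTh2009, Def 2.5 p.39] -/
@[simp] theorem TK.kum_inK (h : kumPiC l) (t : Multiplicative (ZMod 2)) : TK.kum l (TK.inK l h t) = h := rfl

/-- `two (inK h t) = t`. (toy bookkeeping) [cite: MochizukiEtTh2009, Def 2.5 p.39] -/
@[simp] theorem TK.two_inK (h : kumPiC l) (t : Multiplicative (ZMod 2)) : TK.two l (TK.inK l h t) = t := rfl

/-! ## 2. The carriers `Π_C = A × Ẑ`, `Π^tp_C = A × ℤ` and the coordinate `Φ` -/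

/-- `Π_C := A × Ẑ` (`Ẑ` = abc-iut-w5-d118's `TemperedModel.Zhat`). (toy bookkeeping) [cite: MochizukiEtTh2009, Def 2.1 p.36] -/
abbrev PiCK : Type := TK l × Zhat

/-- `Π^tp_C := A × ℤ` (discrete). (toy bookkeeping) [cite: MochizukiEtTh2009, Def 2.5 p.39] -/
abbrev GtpK : Type := TK l × Multiplicative ℤ

/-- `Π^tp_C ↪ Π_C`: `id_A × η_ℤ`. (toy bookkeeping) [cite: MochizukiEtTh2009, Def 2.5 p.39] -/
def toHatK : GtpK l →ₜ* PiCK l := (ContinuousMonoidHom.id (TK l)).prodMap (etaCont (Multiplicative ℤ))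

/-- `Π^tp_C ↪ Π_C` on elements. (toy bookkeeping) [cite: MochizukiEtTh2009, Def 2.5 p.39] -/
@[simp] theorem toHatK_apply (a : TK l) (n : Multiplicative ℤ) : toHatK l (a, n) = (a, etaCont (Multiplicative ℤ) n) := rfl

/-- `Φ := pr ∘ pr₁ : Π_C → (ℤ/l)³ ⋊ D_l`. (toy bookkeeping) [cite: MochizukiEtTh2009, Def 2.1 p.36] -/
def PhiK : PiCK l →* kumPiC l := (TK.kum l).comp (MonoidHom.fst _ _)

/-- `Φ (a, z) = pr a`. (toy bookkeeping) [cite: MochizukiEtTh2009, Def 2.1 p.36] -/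
@[simp] theorem PhiK_apply (x : PiCK l) : PhiK l x = TK.kum l x.1 := rfl

/-- `Φ^tp := pr ∘ pr₁ : Π^tp_C → (ℤ/l)³ ⋊ D_l` (`= Φ ∘ (Π^tp_C ↪ Π_C)`). (toy bookkeeping) [cite: MochizukiEtTh2009, Def 2.5 p.39] -/
def PhiG : GtpK l →* kumPiC l := (TK.kum l).comp (MonoidHom.fst _ _)

/-- `Φ^tp (a, n) = pr a`. (toy bookkeeping) [cite: MochizukiEtTh2009, Def 2.5 p.39] -/
@[simp] theorem PhiG_apply (x : GtpK l) : PhiG l x = TK.kum l x.1 := rfl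

/-- `Φ` is surjective. (toy bookkeeping) [cite: MochizukiEtTh2009, Def 2.1 p.36] -/
theorem PhiK_surjective : Function.Surjective (PhiK l) := fun h => ⟨(TK.inK l h 1, 1), TK.kum_inK l h 1⟩

/-- `Φ^tp` is surjective. (toy bookkeeping) [cite: MochizukiEtTh2009, Def 2.5 p.39] -/
theorem PhiG_surjective : Function.Surjective (PhiG l) := fun h => ⟨(TK.inK l h 1, 1), TK.kum_inK l h 1⟩

/-- `Φ` is continuous (preimages of arbitrary subsets are open). (toy bookkeeping) [cite: MochizukiEtTh2009, Def 2.1 p.36] -/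
theorem isOpen_preimage_PhiK (S : Set (kumPiC l)) : IsOpen (PhiK l ⁻¹' S) := by
  have : PhiK l ⁻¹' S = (fun x : PiCK l => x.1) ⁻¹' {a | TK.kum l a ∈ S} := rfl
  rw [this]
  exact (isOpen_discrete _).preimage continuous_fst

/-- … and closed. (toy bookkeeping) [cite: MochizukiEtTh2009, Def 2.1 p.36] -/
theorem isClosed_preimage_PhiK (S : Set (kumPiC l)) : IsClosed (PhiK l ⁻¹' S) := by
  rw [← isOpen_compl_iff, ← Set.preimage_compl]
  exact isOpen_preimage_PhiK l _

/-! ## 3. The augmentation onto `G_K = ℤ/l` and the subgroups of Def. 2.1 -/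

/-- **`aug := z ∘ Φ : Π_C ↠ G_K = ℤ/l`.** (toy bookkeeping) [cite: MochizukiEtTh2009, Def 2.1 p.36] -/
def augK : PiCK l →* Multiplicative (ZMod l) := (aug l).comp (PhiK l)

/-- `Ker(aug) = Φ⁻¹(Ker z)`. (toy bookkeeping) [cite: MochizukiEtTh2009, Def 2.1 p.36] -/
theorem augK_ker : (augK l).ker = ((aug l).ker).comap (PhiK l) := rfl

/-- `Π_X := Φ⁻¹(kumPiX)` (index `2`). (toy bookkeeping) [cite: MochizukiEtTh2009, Def 2.1 p.36] -/
def PiXK : Subgroup (PiCK l) := (kumPiX l).comap (PhiK l)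

/-- **`Δ̄_Θ-preimage := Φ⁻¹(centre)`.** (toy bookkeeping) [cite: MochizukiEtTh2009, Def 2.1 p.36] -/
def barThetaK : Subgroup (PiCK l) := (kumZ l).comap (PhiK l)

/-- **`Ker(Δ_X ↠ Δ̄_X) := Ker Φ`.** (toy bookkeeping) [cite: MochizukiEtTh2009, Def 2.1 p.36] -/
def barKerK : Subgroup (PiCK l) := (PhiK l).ker

/-- **`D_x := Φ⁻¹⟨c, g⟩`.** (toy bookkeeping) [cite: MochizukiEtTh2009, Def 2.1 p.36] -/
def DxK : Subgroup (PiCK l) := (kumDx l).comap (PhiK l)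

/-- `Ker Φ ⊆ Φ⁻¹(H)` for every `H`. (toy bookkeeping) [cite: MochizukiEtTh2009, Def 2.1 p.36] -/
theorem barKerK_le_comap (H : Subgroup (kumPiC l)) : barKerK l ≤ H.comap (PhiK l) := fun x hx => by
  rw [Subgroup.mem_comap, (MonoidHom.mem_ker).mp hx]
  exact H.one_mem

/-- `Δ_X = Π_X ∩ Ker(aug) = Φ⁻¹(kumPiX ∩ Ker z)`. (toy bookkeeping) [cite: MochizukiEtTh2009, Def 2.1 p.36] -/
theorem deltaK_eq : PiXK l ⊓ (augK l).ker = (kumPiX l ⊓ (aug l).ker).comap (PhiK l) := by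
  rw [augK_ker, PiXK, ← Subgroup.comap_inf]

/-- `[Δ̄_Θ-preimage : Ker Φ] = #centre = l`. (toy bookkeeping) [cite: MochizukiEtTh2009, Def 2.1 p.36] -/
theorem relIndex_barKerK : (barKerK l).relIndex (barThetaK l) = l := by
  rw [barKerK, ← MonoidHom.comap_bot, barThetaK, Subgroup.relIndex_comap,
    Subgroup.map_comap_eq_self_of_surjective (PhiK_surjective l), Subgroup.relIndex_bot_left, card_kumZ]

/-- The `(x, a)`-coordinates `Δ_X ↠ (ℤ/l)²` (`ellCoords ∘ Φ`). (toy bookkeeping) [cite: MochizukiEtTh2009, Def 2.1 p.36] -/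
def ellCoordsK : ↥(PiXK l ⊓ (augK l).ker) →* Multiplicative (ZMod l × ZMod l) :=
  (ellCoords l).comp
    (((PhiK l).comp (PiXK l ⊓ (augK l).ker).subtype).codRestrict _ fun g => ⟨g.2.1, g.2.2⟩)

/-- They are onto. (toy bookkeeping) [cite: MochizukiEtTh2009, Def 2.1 p.36] -/
theorem ellCoordsK_surjective : Function.Surjective (ellCoordsK l) := by
  intro y
  obtain ⟨⟨h, hh⟩, rfl⟩ := ellCoords_surjective l y
  obtain ⟨x, hx⟩ := PhiK_surjective l h
  refine ⟨⟨x, ⟨show PhiK l x ∈ kumPiX l by rw [hx]; exact hh.1, show PhiK l x ∈ (aug l).ker by rw [hx]; exact hh.2⟩⟩, ?_⟩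
  change ellCoords l ⟨PhiK l x, _⟩ = ellCoords l ⟨h, hh⟩
  congr 1
  exact Subtype.ext hx

/-- Their kernel is `Δ̄_Θ-preimage`. (toy bookkeeping) [cite: MochizukiEtTh2009, Def 2.1 p.36] -/
theorem ellCoordsK_ker : (ellCoordsK l).ker = (barThetaK l).subgroupOf _ := by
  ext g
  rw [MonoidHom.mem_ker, Subgroup.mem_subgroupOf]
  change ellCoords l ⟨PhiK l g, _⟩ = 1 ↔ PhiK l (g : PiCK l) ∈ kumZ l
  rw [← MonoidHom.mem_ker, ellCoords_ker, Subgroup.mem_subgroupOf]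

/-! ## 4. The profinite cover data `CoverDataAx` of the Kummer-twist model -/

/-- **The Kummer-twist model's `CoverDataAx`** (Def. 2.1, Rmk. 2.1.1, Prop. 2.2 (i) axioms): `Π_C := A × Ẑ`,
**`G_K := ℤ/l`, `aug := z ∘ Φ`**, `Π_X := Φ⁻¹(kumPiX)`, `Δ̄_Θ-preimage := Φ⁻¹(centre)`, `Ker(Δ_X ↠ Δ̄_X) := Ker Φ`,
`D_x := Φ⁻¹⟨c, g⟩`.  Every axiom is a toy fact of `ThetaCoversKummerTwistSubgroups.lean` read through `Φ`: centrality of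
`⟨c⟩`, exponent `l` of `Δ_X`, the reflections inverting `Δ_X` modulo `⟨c⟩`, `D_x ∩ Δ_X = ⟨c⟩`, `D_x ↠ G_K`.
CONSISTENCY/TOY — not the profinite fundamental group of a curve. [cite: MochizukiEtTh2009, Def 2.1 p.36] -/
abbrev coverDataAx (hl : Odd l) : CoverDataAx.{0} l where
  l_odd := hl
  PiC := PiCK l
  GK := Multiplicative (ZMod l)
  aug := augK l
  PiX := PiXK l
  PiX_normal := by
    haveI := kumPiX_normal l
    exact Subgroup.Normal.comap inferInstance _
  index_PiX := by
    rw [PiXK, Subgroup.index_comap_of_surjective _ (PhiK_surjective l), index_kumPiX]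
  isOpen_PiX := by
    change IsOpen ((PhiK l) ⁻¹' (kumPiX l : Set (kumPiC l)))
    exact isOpen_preimage_PhiK l _
  aug_PiX_surjective := fun t =>
    ⟨⟨(TK.inK l (KummerWitness.mk l 0 0 (toAdd t) (DihedralGroup.r 0)) 1, 1), (mem_kumPiX l).mpr ⟨0, rfl⟩⟩, by
      rw [MonoidHom.restrict_apply]; rfl⟩
  barKer := barKerK l
  barKer_normal := MonoidHom.normal_ker _
  isClosed_barKer := by
    change IsClosed (((PhiK l).ker : Subgroup (PiCK l)) : Set (PiCK l))
    rw [MonoidHom.coe_ker]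
    exact isClosed_preimage_PhiK l _
  barTheta := barThetaK l
  barTheta_normal := (kumZ_normal l).comap _
  barKer_le_barTheta := barKerK_le_comap l _
  barTheta_le := by
    rw [deltaK_eq]
    exact Subgroup.comap_mono (le_inf (kumZ_le_kumPiX l) (kumZ_le_ker_aug l))
  relIndex_barKer := relIndex_barKerK l
  ell_rank_two := by
    haveI : (barThetaK l).Normal := (kumZ_normal l).comap _
    exact ⟨(QuotientGroup.quotientMulEquivOfEq (ellCoordsK_ker l).symm).trans
      (QuotientGroup.quotientKerEquivOfSurjective _ (ellCoordsK_surjective l))⟩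
  barTheta_central := by
    intro t ht d _
    change PhiK l (t * d * t⁻¹ * d⁻¹) = 1
    rw [map_mul, map_mul, map_mul, map_inv, map_inv]
    have h := z_central l (PhiK l d) ht
    have e : PhiK l t * PhiK l d * (PhiK l t)⁻¹ * (PhiK l d)⁻¹ =
        (PhiK l d * PhiK l t * (PhiK l d)⁻¹ * (PhiK l t)⁻¹)⁻¹ := by group
    rw [e, h, inv_one]
  Dx := DxK l
  Dx_le := Subgroup.comap_mono ((kumDx_le_kumH l).trans (kumH_le_kumPiX l))
  aug_Dx_surjective := fun t =>
    ⟨⟨(TK.inK l (KummerWitness.mk l 0 0 (toAdd t) 1) 1, 1), show KummerWitness.mk l 0 0 (toAdd t) 1 ∈ kumDx l from ⟨rfl, rfl⟩⟩,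
      by rw [MonoidHom.restrict_apply]; rfl⟩
  inertia_sup_barKer := by
    rw [augK_ker, DxK, ← Subgroup.comap_inf, kumDx_inf_ker_aug]
    exact sup_eq_left.mpr (barKerK_le_comap l _)
  pow_mem_barKer := by
    intro d hd
    rw [deltaK_eq] at hd
    change PhiK l (d ^ l) = 1
    rw [map_pow]
    exact pow_eq_one l hd.1 ((mem_ker_aug l).mp hd.2)
  inv_ell := by
    intro c hc hcX d hd
    rw [deltaK_eq] at hd
    have hc' : PhiK l c ∈ (aug l).ker := hc
    change PhiK l (c * d * c⁻¹ * d) ∈ kumZ l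
    rw [map_mul, map_mul, map_mul, map_inv]
    exact inv_ell l hcX ((mem_ker_aug l).mp hc') hd.1 ((mem_ker_aug l).mp hd.2)
  inv_theta := by
    intro c _ _ t ht
    change PhiK l (c * t * c⁻¹ * t⁻¹) = 1
    rw [map_mul, map_mul, map_mul, map_inv, map_inv]
    exact z_central l (PhiK l c) ht

/-! ## 5. The data of the orbicurve `C̲̲` (Def. 2.3) and of the tempered layer (Def. 2.5) — properties in parts 2–3 -/

/-- `Π_C̲ := Φ⁻¹((ℤ/l)³ ⋊ {1, s r})`. (toy bookkeeping) [cite: MochizukiEtTh2009, Def 2.1 p.36] -/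
def HpK : Subgroup (PiCK l) := (kumHp l).comap (PhiK l)

/-- The inversion `ι̲ := ((s r, 1), 1)`. (toy bookkeeping) [cite: MochizukiEtTh2009, Prop 2.2 p.36] -/
def iotaK : PiCK l := (TK.inK l (iota l) 1, 1)

/-- `E := Φ⁻¹(⟨(1, −1, 0)⟩)` (`Im(s_ι)` of Prop. 2.2 (i): the `(−1)`-eigenline of `ι̲ = s r`). (toy bookkeeping)
[cite: MochizukiEtTh2009, Prop 2.2 (i) p.37] -/
def EK : Subgroup (PiCK l) := (kumE l).comap (PhiK l)

/-- The splitting `S := Φ⁻¹⟨g⟩` of `D_x ↠ G_K`. (toy bookkeeping) [cite: MochizukiEtTh2009, Prop 2.2 (ii) p.37] -/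
def SK : Subgroup (PiCK l) := (kumS l).comap (PhiK l)

/-- `Π_C̲̲ := Φ⁻¹({y = −x} ⋊ {1, s r})` (`= (S · E) · ⟨ι̲⟩`, part 2). (toy bookkeeping) [cite: MochizukiEtTh2009, Def 2.3 p.38] -/
def PiCuuK : Subgroup (PiCK l) := (kumCuu l).comap (PhiK l)

/-- `A_X := pr⁻¹(kumPiX) ⊆ A` (the `Π^tp_X`-part of the finite factor). (toy bookkeeping) [cite: MochizukiEtTh2009, Def 2.5 p.39] -/
def TKX : Subgroup (TK l) := (kumPiX l).comap (TK.kum l)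

/-- The tempered inversion `ι̲ = ((s r, 1), 0) ∈ Π^tp_C = A × ℤ`. (toy bookkeeping) [cite: MochizukiEtTh2009, Prop 2.2 p.36] -/
def iotaG : GtpK l := (TK.inK l (iota l) 1, 1)

/-- `toHat ι̲^tp = ι̲`. (toy bookkeeping) [cite: MochizukiEtTh2009, Prop 2.2 p.36] -/
theorem toHatK_iotaG : toHatK l (iotaG l) = iotaK l := by
  rw [iotaG, toHatK_apply, map_one]; rfl

end KummerModel

end ThetaCovers

end Literature.AnabelianGeometry.EtaleTheta
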